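import Literature.Probability.RandomPlanarGeometry.SLERestrictionLemmasKappa
import Literature.Probability.RandomPlanarGeometry.SLERestrictionLocal
import HarnessLib

/-!
# [LSW] Lemma 6.2 along SLE_κ (`0 < κ ≤ 4`) for every `A ∈ 𝒬*`: minus hulls, two-sided unions

Sequel to `SLERestrictionLemmasKappa` (Lemma 6.2 along SLE_κ for `A ∈ 𝒬₊`,
`sle_restrictionDeriv_frequently_gtK_of_isPlusHull`), after G. F. Lawler, O. Schramm, W. Werner,
*Conformal restriction: the chordal case* (2003), §6 Lemma 6.2 ("for `A ∈ 𝒬₊`; … uses the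
reflection for `𝒬₋`") and the proofs of Thm. 6.1/6.5, where the lim-sup property
`limsup_{t → ∞} Φ′_{A_t − W_t}(0) = 1` on `{γ ∩ A = ∅}` is needed for the hull at hand.

General-`κ` twins of the SLE_{8/3} theorems of `SLERestrictionLocal` /
`SLERestrictionSlidHull` (all deterministic inputs being theorems of the tree, stated for any
continuous driving function generated by a simple curve):

* `sle_restrictionDeriv_frequently_gtK_of_isMinusHull` — `A ∈ 𝒬₋` (reflection,
  `Loewner.restrictionDeriv_exitTime_gt_of_isMinusHull_simple`);
* `sle_restrictionDeriv_frequently_gtK_of_union` — a two-sided hull `A = A₊ ∪ A₋` (Lemma 6.2 for each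
  part at a common exit time, and the subadditivity `1 − Φ′_{B₊ ∪ B₋} ≤ (1 − Φ′_{B₊}) + (1 − Φ′_{B₋})`,
  `HasRestrictionDeriv.one_sub_le_add`);
* **`sle_restrictionDeriv_frequently_gtK_of_isStarHull`** — every `A ∈ 𝒬*`, by the decomposition
  into side parts (`IsStarHull.sidePart_decomposition`).

## References

* [LSW] Lemma 6.2 and proofs of Thm. 6.1/6.5 (§6). [LawlerSchrammWerner2003Restriction]
* S. Rohde, O. Schramm, *Basic properties of SLE* (2005), Thm 5.1, 6.1, 7.1. [RohdeSchramm2005]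
-/

noncomputable section

open Set Filter MeasureTheory
open UpperHalfPlane (upperHalfPlaneSet)
open scoped NNReal Topology

namespace Literature.Probability.RandomPlanarGeometry

section SLE

variable {κ : ℝ≥0} {A : Set ℂ}

/-- The Rohde–Schramm inputs at `0 < κ ≤ 4`: generation by a curve, simplicity, transience. [folklore] -/
theorem sle_trace_facts_of_le_four (hκ0 : 0 < κ) (hκ4 : κ ≤ 4) :
    HasSLETrace κ ∧ (∀ᵐ ω ∂Process.preWienerMeasure, Loewner.IsSimpleTrace (sleTrace κ ω)) ∧
      ∀ᵐ ω ∂Process.preWienerMeasure, Tendsto (fun t ↦ ‖sleTrace κ ω t‖) atTop atTop := by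
  have hκ8 : κ ≠ 8 := by
    intro h; rw [h] at hκ4; norm_num at hκ4
  exact ⟨hasSLETrace_of_ne_eight_holds hκ8,
    ae_isSimpleTrace_sleTrace_of_le_four_of_hasSLETrace_fact hasSLETrace_of_ne_eight_holds hκ0 hκ4,
    tendsto_norm_sleTrace_atTop_of_ne_eight hκ0 hκ8⟩

/-- **[LSW] Lemma 6.2 along SLE_κ, `0 < κ ≤ 4`, for `A ∈ 𝒬₋`** (by reflection).
[cite: LawlerSchrammWerner2003Restriction, Lemma 6.2 and proofs of Thm. 6.1/6.5 (§6)] -/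
theorem sle_restrictionDeriv_frequently_gtK_of_isMinusHull (hκ0 : 0 < κ) (hκ4 : κ ≤ 4) (hA : IsMinusHull A) :
    sle_restrictionDeriv_frequently_gtK κ A := by
  obtain ⟨hgen, hsimple, htr⟩ := sle_trace_facts_of_le_four hκ0 hκ4
  have hswallow : sle_swallowingTime_ofReal_eq_firstHit := sle_swallowingTime_ofReal_eq_firstHit_holds
  filter_upwards [ae_isGeneratedByCurve_sleTrace hgen, hsimple, htr] with ω hgenω hsω htrω hT ε hε
  have hdisj : ∀ t, Disjoint (Loewner.closedHull (sleDriving κ ω) t) A :=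
    disjoint_closedHull hswallow hgenω hsω (firstHit_eq_top_iff_disjoint.1 hT)
  obtain ⟨r₀, hr₀⟩ := Loewner.restrictionDeriv_exitTime_gt_of_isMinusHull_simple
    (continuous_sleDriving _ ω) (sleDriving_zero _ ω) hgenω hsω hA hdisj hε
  rw [frequently_atTop]
  intro a
  obtain ⟨r, hr, t, hat, ht⟩ := exists_isExitTime_ge hswallow hgenω hsω htrω a r₀
  exact ⟨t, hat, hr₀ r hr t ht⟩

/-- **[LSW] Lemma 6.2 along SLE_κ, `0 < κ ≤ 4`, for a two-sided hull `A = A₊ ∪ A₋`.**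
[cite: LawlerSchrammWerner2003Restriction, Lemma 6.2 and proofs of Thm. 6.1/6.5 (§6), with Prop. 4.1] -/
theorem sle_restrictionDeriv_frequently_gtK_of_union (hκ0 : 0 < κ) (hκ4 : κ ≤ 4) {Ap Am : Set ℂ}
    (hA : IsStarHull A) (hAp : IsPlusHull Ap) (hAm : IsMinusHull Am) (hunion : Ap ∪ Am = A) :
    sle_restrictionDeriv_frequently_gtK κ A := by
  obtain ⟨hgen, hsimple, htr⟩ := sle_trace_facts_of_le_four hκ0 hκ4
  have hswallow : sle_swallowingTime_ofReal_eq_firstHit := sle_swallowingTime_ofReal_eq_firstHit_holds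
  have huniq : IsStarHull.existsUnique_isRestrictionMap := IsStarHull.existsUnique_isRestrictionMap_holds
  obtain ⟨Φ, hΦ, -⟩ := huniq hA
  obtain ⟨Φp, hΦp, -⟩ := huniq hAp.1
  obtain ⟨Φm, hΦm, -⟩ := huniq hAm.1
  filter_upwards [ae_isGeneratedByCurve_sleTrace hgen, hsimple, htr] with ω hgenω hsω htrω hT ε hε
  set W := sleDriving κ ω with hWdef
  have hW : Continuous W := continuous_sleDriving _ ω
  have hW0 : W 0 = 0 := sleDriving_zero _ _
  have hγA : Disjoint (range (sleTrace κ ω)) A := firstHit_eq_top_iff_disjoint.1 hT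
  have hγp : Disjoint (range (sleTrace κ ω)) Ap := hγA.mono_right (hunion ▸ subset_union_left)
  have hγm : Disjoint (range (sleTrace κ ω)) Am := hγA.mono_right (hunion ▸ subset_union_right)
  have hε2 : 0 < ε / 2 := by linarith
  obtain ⟨r₁, hr₁⟩ := Loewner.restrictionDeriv_exitTime_gt_simple_holds hW hW0 hgenω hsω hAp
    (disjoint_closedHull hswallow hgenω hsω hγp) (ε / 2) hε2
  obtain ⟨r₂, hr₂⟩ := Loewner.restrictionDeriv_exitTime_gt_of_isMinusHull_simple hW hW0 hgenω hsω hAm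
    (disjoint_closedHull hswallow hgenω hsω hγm) hε2
  rw [frequently_atTop]
  intro a
  obtain ⟨r, hr, t, hat, ht⟩ := exists_isExitTime_ge hswallow hgenω hsω htrω a (max r₁ r₂)
  refine ⟨t, hat, fun Ψ e hΨ he ↦ ?_⟩
  have hdj : ∀ {B : Set ℂ}, Disjoint (range (sleTrace κ ω)) B → Disjoint (sleTrace κ ω '' Icc 0 t) B := fun h ↦
    h.mono_left (image_subset_range _ _)
  have hB : IsStarHull (Loewner.slidHull W A t) := hgenω.isStarHull_slidHull hW hW0 hsω hA hΦ (hdj hγA)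
  have hBp : IsStarHull (Loewner.slidHull W Ap t) := hgenω.isStarHull_slidHull hW hW0 hsω hAp.1 hΦp (hdj hγp)
  have hBm : IsStarHull (Loewner.slidHull W Am t) := hgenω.isStarHull_slidHull hW hW0 hsω hAm.1 hΦm (hdj hγm)
  have hBunion : Loewner.slidHull W Ap t ∪ Loewner.slidHull W Am t = Loewner.slidHull W A t := by
    rw [← Loewner.slidHull_union, hunion]
  obtain ⟨Ψp, hΨp, -⟩ := huniq hBp
  obtain ⟨ep, -, -, hep⟩ := IsStarHull.exists_hasRestrictionDeriv_holds hBp hΨp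
  obtain ⟨Ψm, hΨm, -⟩ := huniq hBm
  obtain ⟨em, -, -, hem⟩ := IsStarHull.exists_hasRestrictionDeriv_holds hBm hΨm
  have h1 : 1 - ε / 2 < ep := hr₁ r ((le_max_left _ _).trans hr) t ht Ψp ep hΨp hep
  have h2 : 1 - ε / 2 < em := hr₂ r ((le_max_right _ _).trans hr) t ht Ψm em hΨm hem
  have hsub := HasRestrictionDeriv.one_sub_le_add hBp hBm hB hBunion hΨp hΨm hΨ hep hem he
  linarith

/-- **[LSW] Lemma 6.2 along SLE_κ, `0 < κ ≤ 4`, for EVERY `A ∈ 𝒬*`** (side-part decomposition).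
[cite: LawlerSchrammWerner2003Restriction, Lemma 6.2 and proofs of Thm. 6.1/6.5 (§6)] -/
theorem sle_restrictionDeriv_frequently_gtK_of_isStarHull (hκ0 : 0 < κ) (hκ4 : κ ≤ 4) (hA : IsStarHull A) :
    sle_restrictionDeriv_frequently_gtK κ A := by
  have hnf := hA.isBoundedHull.isConnected_union_im_nonpos
  obtain ⟨hP, hMi, hunion, -, -, -⟩ := hA.sidePart_decomposition hnf
  rcases (sidePart A (-1)).eq_empty_or_nonempty with hm0 | -
  · have hAeq : sidePart A 1 = A := by
      conv_rhs => rw [← hunion, hm0, union_empty]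
    have key := sle_restrictionDeriv_frequently_gtK_of_isPlusHull hκ0 hκ4 hP
    rwa [hAeq] at key
  rcases (sidePart A 1).eq_empty_or_nonempty with hp0 | -
  · have hAeq : sidePart A (-1) = A := by
      conv_rhs => rw [← hunion, hp0, empty_union]
    have key := sle_restrictionDeriv_frequently_gtK_of_isMinusHull hκ0 hκ4 hMi
    rwa [hAeq] at key
  exact sle_restrictionDeriv_frequently_gtK_of_union hκ0 hκ4 hA hP hMi hunion

end SLE

end Literature.Probability.RandomPlanarGeometry

end
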